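import Literature.NumberTheory.NumberFields.SqrtTwoTowerTwoGaloisAction
import Literature.NumberTheory.IwasawaTheory.ClassicalMuVanishesLayerOneUnitCertificateTwo
import Literature.NumberTheory.IwasawaTheory.ClassNumberPExpLayerOneEqOneOfGenusCertificate
import Literature.NumberTheory.IwasawaTheory.ClassGroupPRankLeOfRelationTwoAnyDepth
import HarnessLib

/-!
# `μ₂ = 0`, `λ₂ ≤ 2` FROM AN INVARIANT CLASS AT LAYER TWO: the t-free relation door of the cyclotomic `ℤ₂`-tower fed by the CHEAPEST
# relation there is — `σ²c = c` for the class `c = [(q₀, s₂ − a)] ∈ Cl(K_2)`, i.e. ONE ideal equation `(y)·σ²𝔠 = (q₀)·𝔠` in `𝓞_{K_2}`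

`Proofs`-style file (theorems only: no definition, no named fact, no instance, no `sorry`) in topic `NumberTheory/IwasawaTheory` (namespace = path),
written by the prover seat `bsd-line-att-p3` g51 (cell `bsd-f1-sign2`, route `AlignedTransportAtTwo`; `--supports` stmt-BirchSwinnertonDyer-22298, closes nothing).
The LAYER-TWO consumer of this lineage's t-free relation door `classicalMuVanishes_two_of_relation_of_genusCert_layer_anyDepth`
(`ClassGroupPRankLeOfRelationTwoAnyDepth`, att-p3 g49) with the relation polynomial **`f = X² − 1 = (X − 1)²·1 + 2·(X − 1)`** (`d = 2 ≤ 2² − 2`):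
the relation `∏ σ^i(c)^{f_i} = c⁻¹·σ²(c) = 1` says that the class `c` is FIXED by `σ²`, the generator of `Gal(K_2/K_1)`.  Every abstract input of the door at
`m = 2` — the generator `σ : s₂ ↦ s₂³ − 3s₂` of `Gal(K_2/K)` (att-p4 g43's `NumberFields/SqrtTwoTowerTwoGaloisAction`), the class `c = [𝔠]`, `𝔠 = (q₀, s₂ − a)`, the genus
datum `N_{K_2/K_1}(c) = [𝔄]`, `N_{K_1/K}(𝔄) = (q₀)`, and the relation — is produced from COORDINATE DATA in `𝓞_K` on the basis `1, s₁, s₂, s₁s₂` of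
`K_2 = K·ℚ(ζ₁₆)⁺` (att-p4 g41's four-coordinate product rule).

* ★★★ `classicalMuVanishes_two_of_invariantClassCert_layer_two` — `K` odd degree, `2 ∤ d_K`, `κ` cyclotomic, two dyadic primes, `2 ∤ h_K`, `𝓞_K/𝔭₁ = 𝔽₂`, units
  `≡ ±1 (mod 𝔭₁³)`; DATA: `q₀ ∈ 𝓞_K` with `(q₀)` maximal and `q₀ ≡ ±3 (mod 𝔭₁³)`; `a ∈ ℤ` and a residue map `ψ : 𝓞_K → ℤ/q` (`q > 1` odd) with `ψ(q₀) = 0`,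
  `P₂(a) = (a²−2)²−2 = 0` in `ℤ/q`; Bézout `α q₀⁴ + β P₂(a) = q₀`; an element `y = y₀ + y₁s₁ + (y₂ + y₃s₁)s₂` with `y = λ q₀ + μ (s₂ − a)` and
  `y·(s₂ + a) = −q₀·(λ' q₀ + μ' (s₂ − a))` in coordinates, and `N_{K_2/K}(y) = ε q₀⁴` (`ε` a unit; the norm read through the two quadratic steps)
  ⟹ **`rank₂ Cl(K_l) ≤ 2 ∀ l`, `μ₂(κ) = 0`, `λ₂(κ) ≤ 2`**.

* ★★ `classicalMuVanishes_two_of_genusCert_of_fixed_layer_two` / `…_layer_three` (§2, ABSTRACT FORM) — same base hypotheses, a class `c` of `Cl(K_2)` (resp. `Cl(K_3)`)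
  with the genus certificate and **`σ²(c) = c`** (resp. **`σ⁴(c) = c`**: fixed by `Gal(K_m/K_{m−1})`) ⟹ `μ₂ = 0`, `λ₂ ≤ 2` (resp. `≤ 4`): **`μ₂ > 0` forces the top step
  of the tower to MOVE every genus-odd class.**

WHY IT IS A PROOF.  `𝔠 = (q₀, s₂ − a)` is proper (residue symbol) with `N_{K_2/K}(𝔠) ⊇ (q₀⁴, P₂(a)) ∋ q₀`, so `N_{K_2/K}(𝔠) = (q₀)` (maximality) and the same
for every conjugate; `σ²𝔠 = (q₀, −s₂ − a)` (`σ² s₂ = −s₂`).  The two memberships say `(y)·σ²𝔠 ⊆ (q₀)·𝔠`; both sides have relative norm `(q₀)⁵` (`N(y) = ε q₀⁴`),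
so they are EQUAL (cancellation of ideals in the Dedekind domain `𝓞_{K_2}`: `N(C) = (1) ⟹ C = (1)`), whence `[σ²𝔠] = [𝔠]` in `Cl(K_2)`.  Then att-p3 g49's door.

CELL READING (crux C2, CONVERSE QUADRANT `t ≥ 4 ∧ e₁ ≥ 2` of the u7 sub-cell, where no door fired before): over such a base the `2`-class group of `K_2` is a
cyclic `Λ`-module with coinvariants of order `4` (Chevalley); if its `2`-rank is `2` and its order `8` its annihilator is `(4, 2T, T²) ∋ X² − 1` (`T = X − 1`), so EVERY
`2`-class of `K_2` is `Gal(K_2/K_1)`-invariant and this certificate exists; first customer `N = 4307` (this seat's row, `q₀ = 11 − 3θ` of norm `127`, `y` with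
one-digit coordinates).  HONEST SCOPE: classical; nothing about any summit is asserted here; BSD is not advanced.

References: [Washington1997] §13.1, §13.3 Prop. 13.22–13.23; [Lang1990] Ch. 13 §4 Lemma 4.1; [Fukuda1994] Thm. 1; [Gras2003] IV.4; [NeukirchANT1999] Ch. I §3
(3.1)–(3.3) (unique factorisation, cancellation), §8, Ch. III (1.6)–(1.7) (relative norm of ideals, transitivity); [Cohen1993] §4.7, §6.5.
-/

set_option autoImplicit false

noncomputable section

open scoped NumberField nonZeroDivisors
open NumberField IsDedekindDomain Module Polynomial Finset

namespace Literature.NumberTheory.IwasawaTheory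

open Literature.NumberTheory.EllipticCurves Literature.NumberTheory.NumberFields Literature.NumberTheory.NumberFields.AmbiguousClass

variable {K : Type} [Field K] [NumberField K]

set_option maxHeartbeats 3200000 in
set_option synthInstance.maxHeartbeats 400000 in
/-- ★★★ **`μ₂ = 0`, `λ₂ ≤ 2`, `rank₂ Cl(K_l) ≤ 2 ∀ l` FROM A `Gal(K_2/K_1)`-INVARIANT CLASS, IN COORDINATES.**  `K` odd degree, `2 ∤ d_K`, `κ` cyclotomic,
exactly two primes above `2`, `2 ∤ h_K`; `P ∋ 2` maximal with `𝓞_K/P = 𝔽₂`; all units `≡ ±1 (mod P³)`.  DATA: `q₀` with `(q₀)` maximal, `q₀ ≡ ±3 (mod P³)`; `a ∈ ℤ`;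
`ψ : 𝓞_K → ℤ/q` (`1 < q`, `2tᵢ = 1`), `ψ q₀ = 0`, `P₂(a) = 0`; `α q₀⁴ + β P₂(a) = q₀`; `y, λ, μ` (four coordinates each) with `y = λq₀ + μ(s₂ − a)`; `λ', μ'` with
`y(s₂ + a) + q₀(λ'q₀ + μ'(s₂ − a)) = 0`; the tower-norm templates `V₀, V₁` of `y` and a unit `ε` with `V₀² − 2V₁² = ε q₀⁴`.
THEN `rank₂ Cl(K_l) ≤ 2` for all `l`, `μ₂(κ) = 0`, `λ₂(κ) ≤ 2`.
[cite: Washington1997, §13.3 Prop. 13.22–13.23] [cite: Lang1990, Ch. 13 §4 Lemma 4.1] [cite: NeukirchANT1999, Ch. III (1.6)–(1.7); Ch. I §3 (3.3)]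
[cite: Cohen1993, §4.7, §6.5] -/
theorem classicalMuVanishes_two_of_invariantClassCert_layer_two (hK2 : ¬ 2 ∣ Module.finrank ℚ K) (hd : ¬ (2 : ℤ) ∣ NumberField.discr K)
    (κ : ZpExtension K 2) (hκ : κ.IsCyclotomic)
    (h2card : {w : HeightOneSpectrum (𝓞 K) | ((2 : ℕ) : 𝓞 K) ∈ w.asIdeal}.ncard = 2)
    (hh : ¬ 2 ∣ classNumber K)
    (P : Ideal (𝓞 K)) [P.IsMaximal] (hres : ∀ r : 𝓞 K, r ∈ P ∨ r - 1 ∈ P) (h2P : (2 : 𝓞 K) ∈ P)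
    (hunits : ∀ u : (𝓞 K)ˣ, (u : 𝓞 K) - 1 ∈ P ^ 3 ∨ (u : 𝓞 K) + 1 ∈ P ^ 3)
    (q₀ : 𝓞 K) (hq₀ : (Ideal.span {q₀}).IsMaximal) (hπ : q₀ - 3 ∈ P ^ 3 ∨ q₀ + 3 ∈ P ^ 3)
    (a : ℤ) {q : ℕ} (hq : 1 < q) (ψ : 𝓞 K →+* ZMod q) (hψ : ψ q₀ = 0) {ti : ZMod q} (hti : 2 * ti = 1)
    (hPa : (((a : ZMod q) ^ 2 - 2) ^ 2 - 2) = 0)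
    (α β : 𝓞 K) (hBez : α * q₀ ^ 4 + β * (((a : 𝓞 K) ^ 2 - 2) ^ 2 - 2) = q₀)
    (y₀ y₁ y₂ y₃ l₀ l₁ l₂ l₃ m₀ m₁ m₂ m₃ k₀ k₁ k₂ k₃ n₀ n₁ n₂ n₃ : 𝓞 K)
    (hy₀ : y₀ = l₀ * q₀ + (-(a : 𝓞 K) * m₀ + 2 * m₂ + 2 * m₃))
    (hy₁ : y₁ = l₁ * q₀ + (-(a : 𝓞 K) * m₁ + m₂ + 2 * m₃))
    (hy₂ : y₂ = l₂ * q₀ + (m₀ - (a : 𝓞 K) * m₂))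
    (hy₃ : y₃ = l₃ * q₀ + (m₁ - (a : 𝓞 K) * m₃))
    (hk₀ : (a : 𝓞 K) * y₀ + 2 * y₂ + 2 * y₃ + q₀ * (k₀ * q₀ + (-(a : 𝓞 K) * n₀ + 2 * n₂ + 2 * n₃)) = 0)
    (hk₁ : (a : 𝓞 K) * y₁ + y₂ + 2 * y₃ + q₀ * (k₁ * q₀ + (-(a : 𝓞 K) * n₁ + n₂ + 2 * n₃)) = 0)
    (hk₂ : y₀ + (a : 𝓞 K) * y₂ + q₀ * (k₂ * q₀ + (n₀ - (a : 𝓞 K) * n₂)) = 0)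
    (hk₃ : y₁ + (a : 𝓞 K) * y₃ + q₀ * (k₃ * q₀ + (n₁ - (a : 𝓞 K) * n₃)) = 0)
    (V₀ V₁ : 𝓞 K) (hV₀ : V₀ = y₀ ^ 2 + 2 * y₁ ^ 2 - 2 * y₂ ^ 2 - 4 * y₃ ^ 2 - 4 * y₂ * y₃)
    (hV₁ : V₁ = 2 * y₀ * y₁ - y₂ ^ 2 - 2 * y₃ ^ 2 - 4 * y₂ * y₃)
    (ε : (𝓞 K)ˣ) (hN : V₀ ^ 2 - 2 * V₁ ^ 2 = ε * q₀ ^ 4) :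
    (∀ l, classGroupPRank κ l ≤ 2) ∧ ClassicalMuVanishes κ ∧ classicalLambda κ ≤ 2 := by
  classical
  haveI : Fact (Nat.Prime 2) := ⟨Nat.prime_two⟩
  -- ### the layers `K₁ ⊂ K₂`
  have h12 : κ.layer 1 ≤ κ.layer 2 := κ.layer_mono one_le_two
  letI alg : Algebra (κ.layer 1) (κ.layer 2) := (IntermediateField.inclusion h12).toRingHom.toAlgebra
  haveI tow : IsScalarTower K (κ.layer 1) (κ.layer 2) :=
    IsScalarTower.of_algebraMap_eq fun x => ((IntermediateField.inclusion h12).commutes x).symm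
  letI : Algebra (κ.layer 1) (κ.layer (1 + 1)) := alg
  haveI : IsScalarTower K (κ.layer 1) (κ.layer (1 + 1)) := tow
  haveI : FiniteDimensional K (κ.layer 1) := κ.finiteDimensional_layer_holds 1
  haveI : FiniteDimensional K (κ.layer 2) := κ.finiteDimensional_layer_holds 2
  haveI : NumberField (κ.layer 1) := NumberField.of_module_finite K _
  haveI : NumberField (κ.layer 2) := NumberField.of_module_finite K _
  haveI : IsGalois K (κ.layer 1) := κ.isGalois_layer_holds 1
  haveI : IsGalois K (κ.layer 2) := κ.isGalois_layer_holds 2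
  haveI : IsGalois (κ.layer 1) (κ.layer 2) := IsGalois.tower_top_of_isGalois K _ _
  haveI : FiniteDimensional (κ.layer 1) (κ.layer 2) := Module.Finite.of_restrictScalars_finite K _ _
  have hdeg1 : Module.finrank K (κ.layer 1) = 2 := by rw [κ.finrank_layer_holds 1, pow_one]
  have hdeg2 : Module.finrank (κ.layer 1) (κ.layer 2) = 2 := finrank_layer_one_layer_two κ
  have hdeg4 : Module.finrank K (κ.layer 2) = 4 := by rw [κ.finrank_layer_holds 2]; norm_num
  -- ### `s₁ = √2 ∈ K₁ ∖ K`, `s₂ = √(2+s₁) ∈ K₂ ∖ K₁` and their integral copies `S₁, S₂ ∈ 𝓞 K₂`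
  obtain ⟨s₁, hs₁, s₂', hs₂', hs₂K''⟩ := exists_sqrt_two_layer_one_sqrt_two_add_layer_two κ hK2 hκ
  set s₂ : κ.layer 2 := s₂' with hs₂def
  have hs₂ : s₂ ^ 2 = algebraMap (κ.layer 1) (κ.layer 2) (2 + s₁) := hs₂'
  have hs₂K : ∀ x : κ.layer 1, algebraMap (κ.layer 1) (κ.layer 2) x ≠ s₂ := fun x hx => hs₂K'' ⟨x, hx⟩
  clear_value s₂
  clear hs₂' hs₂K'' hs₂def
  have hs₁K : ∀ x : K, algebraMap K (κ.layer 1) x ≠ s₁ := forall_algebraMap_ne_of_sq_eq_two hd hs₁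
  have hs₁int : IsIntegral ℤ s₁ := by
    refine ⟨Polynomial.X ^ 2 - Polynomial.C 2, Polynomial.monic_X_pow_sub_C _ two_ne_zero, ?_⟩
    simp [hs₁]
  have hS₁int : IsIntegral ℤ (algebraMap (κ.layer 1) (κ.layer 2) s₁) := map_isIntegral_int _ hs₁int
  have h2int : IsIntegral ℤ (2 : κ.layer 2) := by
    have := isIntegral_algebraMap (R := ℤ) (A := κ.layer 2) (x := (2 : ℤ))
    rwa [map_ofNat] at this
  have hs₂int : IsIntegral ℤ s₂ := by
    refine IsIntegral.of_pow (n := 2) (by norm_num) ?_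
    rw [hs₂, map_add, map_ofNat]
    exact h2int.add hS₁int
  obtain ⟨S₁, hS₁val⟩ : ∃ S : 𝓞 (κ.layer 2),
      algebraMap (𝓞 (κ.layer 2)) (κ.layer 2) S = algebraMap (κ.layer 1) (κ.layer 2) s₁ := ⟨⟨_, hS₁int⟩, rfl⟩
  obtain ⟨S₂, hS₂val⟩ : ∃ S : 𝓞 (κ.layer 2), algebraMap (𝓞 (κ.layer 2)) (κ.layer 2) S = s₂ := ⟨⟨_, hs₂int⟩, rfl⟩
  have hS₁ : S₁ ^ 2 = 2 := by
    apply RingOfIntegers.coe_injective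
    rw [map_pow, map_ofNat, hS₁val, ← map_pow, hs₁, map_ofNat]
  have hS₂ : S₂ ^ 2 = 2 + S₁ := by
    apply RingOfIntegers.coe_injective
    rw [map_pow, map_add, map_ofNat, hS₂val, hS₁val, hs₂, map_add, map_ofNat]
  set f := algebraMap (𝓞 K) (𝓞 (κ.layer 2)) with hf
  have hcoe : ∀ z : 𝓞 K, algebraMap (𝓞 (κ.layer 2)) (κ.layer 2) (f z) = algebraMap K (κ.layer 2) (z : K) := fun z => by
    rw [hf]
    exact (IsScalarTower.algebraMap_apply (𝓞 K) (𝓞 (κ.layer 2)) (κ.layer 2) z).symm.trans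
      (IsScalarTower.algebraMap_apply (𝓞 K) K (κ.layer 2) z)
  have hia : ∀ (τ : (κ.layer 2) ≃ₐ[K] (κ.layer 2)) (x : 𝓞 (κ.layer 2)),
      algebraMap (𝓞 (κ.layer 2)) (κ.layer 2) ((intAut τ : 𝓞 (κ.layer 2) →+* 𝓞 (κ.layer 2)) x) = τ (algebraMap (𝓞 (κ.layer 2)) (κ.layer 2) x) :=
    fun τ x => rfl
  -- ### the generator `σ` of `Gal(K₂/K)` with `σ s₂ = s₂³ − 3 s₂`, `σ² s₂ = −s₂`
  obtain ⟨σ, hσ⟩ := exists_algEquiv_apply_eq_tower2 (K := K) hdeg1 hdeg2 hs₁ hs₁K hs₂ hs₂K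
  have hgen : ∀ τ : (κ.layer 2) ≃ₐ[K] (κ.layer 2), τ ∈ Subgroup.zpowers σ :=
    forall_mem_zpowers_of_apply_eq_tower2 (K := K) hdeg1 hdeg2 hs₁ hs₁K hs₂ hσ
  obtain ⟨-, -, hσ2, -⟩ := tower2_galois_iterates (K := K) hs₁ hs₂ hσ
  -- ### the ideal `I₀ = (q₀, S₂ − a)` and its conjugate `σ² I₀ = (q₀, −S₂ − a)`
  have hq₀0 : q₀ ≠ 0 := fun h0 => by
    rw [h0, Ideal.span_singleton_zero] at hq₀
    exact Ring.ne_bot_of_isMaximal_of_not_isField hq₀ (RingOfIntegers.not_isField K) rfl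
  obtain ⟨b, hb⟩ : ∃ b : 𝓞 (κ.layer 2), b = f q₀ := ⟨_, rfl⟩
  have hbL : algebraMap (𝓞 (κ.layer 2)) (κ.layer 2) b = algebraMap K (κ.layer 2) (q₀ : K) := by rw [hb, hcoe]
  have hb0 : b ≠ 0 := fun h => hq₀0 (by
    have h' : algebraMap (𝓞 (κ.layer 2)) (κ.layer 2) b = 0 := by rw [h, map_zero]
    rw [hbL, map_eq_zero_iff _ (algebraMap K (κ.layer 2)).injective] at h'
    exact RingOfIntegers.coe_injective (by simpa using h'))
  have hI0 : Ideal.span {b, S₂ - a} ≠ ⊥ := fun h => hb0 (by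
    have : b ∈ Ideal.span {b, S₂ - (a : 𝓞 (κ.layer 2))} := Ideal.subset_span (by simp)
    rw [h, Ideal.mem_bot] at this
    exact this)
  have hmapI : ∀ (τ : (κ.layer 2) ≃ₐ[K] (κ.layer 2)) (Z : 𝓞 (κ.layer 2)), algebraMap (𝓞 (κ.layer 2)) (κ.layer 2) Z = τ s₂ - a →
      (Ideal.span {b, S₂ - (a : 𝓞 (κ.layer 2))}).map (intAut τ : 𝓞 (κ.layer 2) →+* 𝓞 (κ.layer 2)) = Ideal.span {b, Z} := by
    intro τ Z hZ
    rw [Ideal.map_span, Set.image_pair]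
    have h1 : (intAut τ : 𝓞 (κ.layer 2) →+* 𝓞 (κ.layer 2)) b = b := by
      apply RingOfIntegers.coe_injective
      rw [hia, hbL]
      exact τ.commutes (q₀ : K)
    have h2 : (intAut τ : 𝓞 (κ.layer 2) →+* 𝓞 (κ.layer 2)) (S₂ - a) = Z := by
      apply RingOfIntegers.coe_injective
      rw [hia, hZ, map_sub, map_intCast, hS₂val, map_sub, map_intCast]
    rw [h1, h2]
  have hZ₂ : algebraMap (𝓞 (κ.layer 2)) (κ.layer 2) (-S₂ - a) = (σ ^ 2) s₂ - a := by
    rw [hσ2, map_sub, map_neg, map_intCast, hS₂val]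
  have hmap2 := hmapI (σ ^ 2) _ hZ₂
  -- ### norms: `N(I₀) = (q₀)`
  have hnormq : Algebra.intNorm (𝓞 K) (𝓞 (κ.layer 2)) b = q₀ ^ 4 := by
    apply RingOfIntegers.coe_injective
    rw [Algebra.algebraMap_intNorm (A := 𝓞 K) (K := K) (L := κ.layer 2) (B := 𝓞 (κ.layer 2)) b, hbL, Algebra.norm_algebraMap, hdeg4, map_pow]
  have hnormz : Algebra.intNorm (𝓞 K) (𝓞 (κ.layer 2)) (S₂ - a) = ((a : 𝓞 K) ^ 2 - 2) ^ 2 - 2 := by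
    apply RingOfIntegers.coe_injective
    rw [Algebra.algebraMap_intNorm (A := 𝓞 K) (K := K) (L := κ.layer 2) (B := 𝓞 (κ.layer 2)) (S₂ - a), map_sub, map_intCast, hS₂val]
    have hz : (s₂ - a : κ.layer 2) = algebraMap K (κ.layer 2) (-(a : K)) + algebraMap K (κ.layer 2) 0 * algebraMap (κ.layer 1) (κ.layer 2) s₁
        + (algebraMap K (κ.layer 2) 1 + algebraMap K (κ.layer 2) 0 * algebraMap (κ.layer 1) (κ.layer 2) s₁) * s₂ := by
      simp only [map_neg, map_intCast, map_zero, map_one]; ring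
    rw [hz, norm_tower2_eq hdeg1 hdeg2 hs₁ hs₁K hs₂ hs₂K]
    simp only [map_sub, map_pow, map_intCast, map_ofNat]
    ring
  have hqmem : q₀ ∈ Ideal.relNorm (𝓞 K) (Ideal.span {b, S₂ - (a : 𝓞 (κ.layer 2))}) := by
    have h1 : Algebra.intNorm (𝓞 K) (𝓞 (κ.layer 2)) b ∈ Ideal.relNorm (𝓞 K) (Ideal.span {b, S₂ - (a : 𝓞 (κ.layer 2))}) :=
      Ideal.intNorm_mem_spanNorm (R := 𝓞 K) (Ideal.subset_span (by simp))
    have h2 : Algebra.intNorm (𝓞 K) (𝓞 (κ.layer 2)) (S₂ - a) ∈ Ideal.relNorm (𝓞 K) (Ideal.span {b, S₂ - (a : 𝓞 (κ.layer 2))}) :=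
      Ideal.intNorm_mem_spanNorm (R := 𝓞 K) (Ideal.subset_span (by simp))
    rw [hnormq] at h1
    rw [hnormz] at h2
    rw [← hBez]
    exact Ideal.add_mem _ (Ideal.mul_mem_left _ _ h1) (Ideal.mul_mem_left _ _ h2)
  have hI0top : Ideal.span {b, S₂ - (a : 𝓞 (κ.layer 2))} ≠ ⊤ := by
    rw [hb]
    exact span_pair_ne_top_of_residue_tower2 hdeg1 hdeg2 hs₁ hs₁K hs₂ hs₂K q₀ a hq ψ hψ hti hPa hS₂val
  have hNI₀ : Ideal.relNorm (𝓞 K) (Ideal.span {b, S₂ - (a : 𝓞 (κ.layer 2))}) = Ideal.span {q₀} := by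
    have hle : Ideal.span {q₀} ≤ Ideal.relNorm (𝓞 K) (Ideal.span {b, S₂ - (a : 𝓞 (κ.layer 2))}) := (Ideal.span_singleton_le_iff_mem _).mpr hqmem
    have hne : Ideal.relNorm (𝓞 K) (Ideal.span {b, S₂ - (a : 𝓞 (κ.layer 2))}) ≠ ⊤ := fun htop => hI0top (by
      have h := Ideal.relNorm_le_comap (𝓞 K) (Ideal.span {b, S₂ - (a : 𝓞 (κ.layer 2))})
      rw [htop, top_le_iff, Ideal.comap_eq_top_iff] at h
      exact h)
    exact (hq₀.eq_of_le hne hle).symm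
  have hconj : ∀ τ : (κ.layer 2) ≃ₐ[K] (κ.layer 2),
      Ideal.relNorm (𝓞 K) ((Ideal.span {b, S₂ - (a : 𝓞 (κ.layer 2))}).map (intAut τ : 𝓞 (κ.layer 2) →+* 𝓞 (κ.layer 2))) = Ideal.span {q₀} := by
    intro τ
    have hpt : ∀ x : 𝓞 (κ.layer 2), (intAut τ : 𝓞 (κ.layer 2) →+* 𝓞 (κ.layer 2)) x = galRestrict (𝓞 K) K (κ.layer 2) (𝓞 (κ.layer 2)) τ x := by
      intro x
      apply RingOfIntegers.coe_injective
      rw [hia, algebraMap_galRestrict_apply]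
    have hm : (Ideal.span {b, S₂ - (a : 𝓞 (κ.layer 2))}).map (intAut τ : 𝓞 (κ.layer 2) →+* 𝓞 (κ.layer 2)) =
        (Ideal.span {b, S₂ - (a : 𝓞 (κ.layer 2))}).map (galRestrict (𝓞 K) K (κ.layer 2) (𝓞 (κ.layer 2)) τ) := by
      unfold Ideal.map
      congr 1
      ext z
      simp only [Set.mem_image, SetLike.mem_coe, hpt]
    rw [hm, Ideal.relNorm_map_algEquiv, hNI₀]
  -- ### the element `y` and its norm `N(y) = ε q₀⁴`
  obtain ⟨Y, hY⟩ : ∃ Y : 𝓞 (κ.layer 2), Y = f y₀ + f y₁ * S₁ + (f y₂ + f y₃ * S₁) * S₂ := ⟨_, rfl⟩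
  have hnormy : Algebra.intNorm (𝓞 K) (𝓞 (κ.layer 2)) Y = ε * q₀ ^ 4 := by
    apply RingOfIntegers.coe_injective
    rw [Algebra.algebraMap_intNorm (A := 𝓞 K) (K := K) (L := κ.layer 2) (B := 𝓞 (κ.layer 2))]
    have hz : algebraMap (𝓞 (κ.layer 2)) (κ.layer 2) Y =
        algebraMap K (κ.layer 2) (y₀ : K) + algebraMap K (κ.layer 2) (y₁ : K) * algebraMap (κ.layer 1) (κ.layer 2) s₁
        + (algebraMap K (κ.layer 2) (y₂ : K) + algebraMap K (κ.layer 2) (y₃ : K) * algebraMap (κ.layer 1) (κ.layer 2) s₁) * s₂ := by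
      rw [hY]; simp only [map_add, map_mul, hcoe, hS₁val, hS₂val]
    have gV₀ := congrArg (algebraMap (𝓞 K) K) hV₀
    have gV₁ := congrArg (algebraMap (𝓞 K) K) hV₁
    have gN := congrArg (algebraMap (𝓞 K) K) hN
    simp only [map_add, map_sub, map_mul, map_pow, map_ofNat] at gV₀ gV₁ gN
    rw [gV₀, gV₁] at gN
    rw [hz, norm_tower2_eq hdeg1 hdeg2 hs₁ hs₁K hs₂ hs₂K, map_mul, map_pow]
    exact gN
  -- ### the inclusion `(y)·σ²I₀ ⊆ (q₀)·I₀` from the two memberships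
  have hYb : Y * b ∈ Ideal.span {b} * Ideal.span {b, S₂ - (a : 𝓞 (κ.layer 2))} := by
    have e₀ := congrArg f hy₀
    have e₁ := congrArg f hy₁
    have e₂ := congrArg f hy₂
    have e₃ := congrArg f hy₃
    simp only [map_add, map_sub, map_mul, map_neg, map_intCast, map_ofNat] at e₀ e₁ e₂ e₃
    rw [← hb] at e₀ e₁ e₂ e₃
    have hYeq : Y = (f l₀ + f l₁ * S₁ + (f l₂ + f l₃ * S₁) * S₂) * b + (f m₀ + f m₁ * S₁ + (f m₂ + f m₃ * S₁) * S₂) * (S₂ - a) := by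
      rw [hY]
      linear_combination e₀ + S₁ * e₁ + S₂ * e₂ + S₁ * S₂ * e₃ + (-(f m₂ + f m₃ * S₁)) * hS₂ + (-(f m₃)) * hS₁
    have hmem1 : b * b ∈ Ideal.span {b} * Ideal.span {b, S₂ - (a : 𝓞 (κ.layer 2))} :=
      Ideal.mul_mem_mul (Ideal.mem_span_singleton_self b) (Ideal.subset_span (by simp))
    have hmem2 : b * (S₂ - a) ∈ Ideal.span {b} * Ideal.span {b, S₂ - (a : 𝓞 (κ.layer 2))} :=
      Ideal.mul_mem_mul (Ideal.mem_span_singleton_self b) (Ideal.subset_span (by simp))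
    have : Y * b = (f l₀ + f l₁ * S₁ + (f l₂ + f l₃ * S₁) * S₂) * (b * b) + (f m₀ + f m₁ * S₁ + (f m₂ + f m₃ * S₁) * S₂) * (b * (S₂ - a)) := by
      rw [hYeq]; ring
    rw [this]
    exact Ideal.add_mem _ (Ideal.mul_mem_left _ _ hmem1) (Ideal.mul_mem_left _ _ hmem2)
  have hYZ : Y * (-S₂ - a) ∈ Ideal.span {b} * Ideal.span {b, S₂ - (a : 𝓞 (κ.layer 2))} := by
    have e₀ := congrArg f hk₀
    have e₁ := congrArg f hk₁
    have e₂ := congrArg f hk₂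
    have e₃ := congrArg f hk₃
    simp only [map_add, map_sub, map_mul, map_neg, map_intCast, map_ofNat, map_zero] at e₀ e₁ e₂ e₃
    rw [← hb] at e₀ e₁ e₂ e₃
    have hYeq : Y * (-S₂ - a) = (f k₀ + f k₁ * S₁ + (f k₂ + f k₃ * S₁) * S₂) * (b * b) + (f n₀ + f n₁ * S₁ + (f n₂ + f n₃ * S₁) * S₂) * (b * (S₂ - a)) := by
      rw [hY]
      linear_combination (-1 : 𝓞 (κ.layer 2)) * e₀ + (-S₁) * e₁ + (-S₂) * e₂ + (-(S₁ * S₂)) * e₃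
        + (-(f y₂ + f y₃ * S₁ + b * (f n₂ + f n₃ * S₁))) * hS₂ + (-(f y₃ + b * f n₃)) * hS₁
    have hmem1 : b * b ∈ Ideal.span {b} * Ideal.span {b, S₂ - (a : 𝓞 (κ.layer 2))} :=
      Ideal.mul_mem_mul (Ideal.mem_span_singleton_self b) (Ideal.subset_span (by simp))
    have hmem2 : b * (S₂ - a) ∈ Ideal.span {b} * Ideal.span {b, S₂ - (a : 𝓞 (κ.layer 2))} :=
      Ideal.mul_mem_mul (Ideal.mem_span_singleton_self b) (Ideal.subset_span (by simp))
    rw [hYeq]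
    exact Ideal.add_mem _ (Ideal.mul_mem_left _ _ hmem1) (Ideal.mul_mem_left _ _ hmem2)
  have hle : Ideal.span {Y} * Ideal.span {b, -S₂ - (a : 𝓞 (κ.layer 2))} ≤ Ideal.span {b} * Ideal.span {b, S₂ - (a : 𝓞 (κ.layer 2))} := by
    refine Ideal.mul_le.mpr fun x hx z hz => ?_
    obtain ⟨c, rfl⟩ := Ideal.mem_span_singleton'.mp hx
    obtain ⟨u, v, rfl⟩ := Ideal.mem_span_pair.mp hz
    have : c * Y * (u * b + v * (-S₂ - a)) = (c * u) * (Y * b) + (c * v) * (Y * (-S₂ - a)) := by ring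
    rw [this]
    exact Ideal.add_mem _ (Ideal.mul_mem_left _ _ hYb) (Ideal.mul_mem_left _ _ hYZ)
  -- ### equality `(y)·σ²I₀ = (q₀)·I₀` by comparing relative norms
  have hNlhs : Ideal.relNorm (𝓞 K) (Ideal.span {Y} * Ideal.span {b, -S₂ - (a : 𝓞 (κ.layer 2))}) = Ideal.span {q₀} ^ 4 * Ideal.span {q₀} := by
    rw [map_mul, ← hmap2, hconj, Ideal.relNorm_singleton, hnormy, Ideal.span_singleton_pow]
    congr 1
    exact Ideal.span_singleton_eq_span_singleton.mpr ⟨ε⁻¹, by simp [mul_comm]⟩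
  have hNrhs : Ideal.relNorm (𝓞 K) (Ideal.span {b} * Ideal.span {b, S₂ - (a : 𝓞 (κ.layer 2))}) = Ideal.span {q₀} ^ 4 * Ideal.span {q₀} := by
    rw [map_mul, Ideal.relNorm_singleton, hnormq, Ideal.span_singleton_pow, hNI₀]
  have heq : Ideal.span {Y} * Ideal.span {b, -S₂ - (a : 𝓞 (κ.layer 2))} = Ideal.span {b} * Ideal.span {b, S₂ - (a : 𝓞 (κ.layer 2))} := by
    obtain ⟨C, hC⟩ := Ideal.dvd_iff_le.mpr hle
    have hne : Ideal.span {q₀} ^ 4 * Ideal.span {q₀} ≠ 0 := by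
      have h1 : Ideal.span ({q₀} : Set (𝓞 K)) ≠ 0 := by rw [Ne, Ideal.zero_eq_bot, Ideal.span_singleton_eq_bot]; exact hq₀0
      exact mul_ne_zero (pow_ne_zero _ h1) h1
    have hNC : Ideal.relNorm (𝓞 K) C = ⊤ := by
      have h := congrArg (Ideal.relNorm (𝓞 K)) hC
      rw [hNlhs, map_mul, hNrhs] at h
      have h' : (Ideal.span {q₀} ^ 4 * Ideal.span {q₀}) * Ideal.relNorm (𝓞 K) C = (Ideal.span {q₀} ^ 4 * Ideal.span {q₀}) * ⊤ := by
        rw [Ideal.mul_top]; exact h.symm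
      exact mul_left_cancel₀ hne h'
    have hCtop : C = ⊤ := by
      by_contra hC'
      obtain ⟨M, hM, hCM⟩ := Ideal.exists_le_maximal C hC'
      have h := Ideal.relNorm_mono (𝓞 K) hCM
      rw [hNC, top_le_iff] at h
      haveI := hM
      haveI : (M.under (𝓞 K)).IsMaximal := Ideal.IsMaximal.under (𝓞 K) M
      rw [Ideal.relNorm_eq_pow_of_isMaximal M (M.under (𝓞 K)), Ideal.pow_eq_top_iff] at h
      rcases h with h | h
      · exact (Ideal.IsMaximal.ne_top inferInstance) h
      · exact (Ideal.inertiaDeg_pos M (R := 𝓞 K)).ne' h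
    rw [hC, hCtop, Ideal.mul_top]
  -- ### the class relation `σ²(c) = c`
  obtain ⟨Jnz, hJnz⟩ : ∃ J : (Ideal (𝓞 (κ.layer 2)))⁰, (J : Ideal (𝓞 (κ.layer 2))) = Ideal.span {b, S₂ - (a : 𝓞 (κ.layer 2))} :=
    ⟨⟨_, mem_nonZeroDivisors_of_ne_zero hI0⟩, rfl⟩
  have hYne : Y ≠ 0 := fun h0 => by
    have h := hnormy
    rw [h0, Algebra.intNorm_zero] at h
    exact (mul_ne_zero (Units.ne_zero ε) (pow_ne_zero 4 hq₀0)) h.symm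
  have hfix : ClassGroup.mulEquiv (intAut (σ ^ 2)) (ClassGroup.mk0 Jnz) = ClassGroup.mk0 Jnz := by
    rw [mulEquiv_mk0 (σ ^ 2) Jnz, ClassGroup.mk0_eq_mk0_iff]
    refine ⟨Y, b, hYne, hb0, ?_⟩
    dsimp only
    rw [hJnz, hmap2, heq]
  have hf0 : (fun i : ℕ => if i = 0 then (-1 : ℤ) else if i = 2 then 1 else 0) 0 = -1 := by norm_num
  have hf1 : (fun i : ℕ => if i = 0 then (-1 : ℤ) else if i = 2 then 1 else 0) 1 = 0 := by norm_num
  have hf2 : (fun i : ℕ => if i = 0 then (-1 : ℤ) else if i = 2 then 1 else 0) 2 = 1 := by norm_num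
  have hrel : ∏ i ∈ range 3, (ClassGroup.mulEquiv (intAut (σ ^ i)) (ClassGroup.mk0 Jnz)) ^
      ((fun i : ℕ => if i = 0 then (-1 : ℤ) else if i = 2 then 1 else 0) i) = 1 := by
    rw [Finset.prod_range_succ, Finset.prod_range_succ, Finset.prod_range_succ, Finset.prod_range_zero, one_mul, hf0, hf1, hf2,
      zpow_zero, mul_one, zpow_one, pow_zero, mulEquiv_intAut_one, MulEquiv.refl_apply, hfix, zpow_neg, zpow_one, inv_mul_cancel]
  -- ### the door
  have hA0 : Ideal.relNorm (𝓞 (κ.layer 1)) (Jnz : Ideal (𝓞 (κ.layer 2))) ≠ ⊥ := by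
    rw [hJnz]
    exact (Ideal.relNorm_eq_bot_iff (R := 𝓞 (κ.layer 1))).not.mpr hI0
  have hA : Ideal.relNorm (𝓞 K) (Ideal.relNorm (𝓞 (κ.layer 1)) (Jnz : Ideal (𝓞 (κ.layer 2)))) ^ 1 = Ideal.span {q₀} := by
    rw [pow_one, Ideal.relNorm_relNorm, hJnz, hNI₀]
  have hcA : classGroupNorm (κ.layer 1) (κ.layer 2) (ClassGroup.mk0 Jnz) =
      ClassGroup.mk0 ⟨Ideal.relNorm (𝓞 (κ.layer 1)) (Jnz : Ideal (𝓞 (κ.layer 2))), mem_nonZeroDivisors_of_ne_zero hA0⟩ :=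
    classGroupNorm_mk0 (κ.layer 1) Jnz
  have hF : (∑ i ∈ range 3, C (((fun i : ℕ => if i = 0 then (-1 : ℤ) else if i = 2 then 1 else 0) i)) * X ^ i : ℤ[X]) =
      (X - 1) ^ 2 * 1 + C (2 : ℤ) * (X - 1) := by
    simp only [Finset.sum_range_succ, Finset.sum_range_zero, zero_add]
    norm_num
    ring
  have hu : ¬ (2 : ℤ) ∣ (1 : ℤ[X]).eval 1 := by norm_num
  exact classicalMuVanishes_two_of_relation_of_genusCert_layer_anyDepth hK2 hd κ hκ h2card hh (m := 2) (by norm_num) P hres h2P hunits hπ hA0 hA σ hgen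
    hcA (N := 3) (d := 2) (by norm_num) hu hF hrel

/-! ## §2 The abstract form: a genus-odd class FIXED by `Gal(K_m/K_{m−1})` forces `μ₂ = 0` (`m = 2`: `λ₂ ≤ 2`; `m = 3`: `λ₂ ≤ 4`) -/

/-- ★★ **`μ₂ > 0` forces `Gal(K_2/K_1)` to MOVE every genus-odd class of `K_2`.**  `K` of odd degree with `2 ∤ d_K` and exactly two primes above `2`, `κ` cyclotomic,
`2 ∤ h_K`, `𝓞_K/𝔭₁ = 𝔽₂`, every unit `≡ ±1 (mod 𝔭₁³)`; `σ` a generator of `Gal(K_2/K)` and `c ∈ Cl(K_2)` with the GENUS CERTIFICATE `(𝔄, k, π)` for `N_{K_2/K_1}(c)`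
(`π ≡ ±3 (mod 𝔭₁³)`).  IF `σ²(c) = c` — the class is fixed by `Gal(K_2/K_1) = ⟨σ²⟩` — THEN **`rank₂ Cl(K_l) ≤ 2 ∀ l`, `μ₂(κ) = 0`, `λ₂(κ) ≤ 2`**: the relation
`c⁻¹·σ²(c) = 1` has coefficient polynomial `X² − 1 = (X−1)²·1 + 2·(X−1)`, `d = 2 ≤ 2² − 2`, and att-p3 g49's t-free relation door applies.  (The coordinate theorem of §1 is
the case where `σ²(c) = c` is certified by ONE ideal equation `(y)·σ²𝔠 = (q₀)·𝔠`.) [cite: Washington1997, §13.3 Prop. 13.22–13.23] [cite: Lang1990, Ch. 13 §4 Lemma 4.1]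
[cite: Gras2003, IV.4] [cite: Fukuda1994, Thm. 1, p. 264] -/
theorem classicalMuVanishes_two_of_genusCert_of_fixed_layer_two (hK2 : ¬ 2 ∣ Module.finrank ℚ K) (hd : ¬ (2 : ℤ) ∣ NumberField.discr K)
    (κ : ZpExtension K 2) (hκ : κ.IsCyclotomic)
    (h2card : {w : HeightOneSpectrum (𝓞 K) | ((2 : ℕ) : 𝓞 K) ∈ w.asIdeal}.ncard = 2)
    (hh : ¬ 2 ∣ classNumber K)
    [NumberField (κ.layer 1)] [NumberField (κ.layer 2)] [Algebra (κ.layer 1) (κ.layer 2)] [IsScalarTower K (κ.layer 1) (κ.layer 2)]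
    (P : Ideal (𝓞 K)) [P.IsMaximal] (hres : ∀ r : 𝓞 K, r ∈ P ∨ r - 1 ∈ P) (h2P : (2 : 𝓞 K) ∈ P)
    (hunits : ∀ u : (𝓞 K)ˣ, (u : 𝓞 K) - 1 ∈ P ^ 3 ∨ (u : 𝓞 K) + 1 ∈ P ^ 3)
    {π : 𝓞 K} (hπ : π - 3 ∈ P ^ 3 ∨ π + 3 ∈ P ^ 3)
    {A : Ideal (𝓞 (κ.layer 1))} (hA0 : A ≠ ⊥) {k : ℕ} (hA : Ideal.relNorm (𝓞 K) A ^ k = Ideal.span {π})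
    (σ : (κ.layer 2) ≃ₐ[K] (κ.layer 2)) (hσ : ∀ τ : (κ.layer 2) ≃ₐ[K] (κ.layer 2), τ ∈ Subgroup.zpowers σ)
    {c : ClassGroup (𝓞 (κ.layer 2))}
    (hcA : classGroupNorm (κ.layer 1) (κ.layer 2) c = ClassGroup.mk0 ⟨A, mem_nonZeroDivisors_of_ne_zero hA0⟩)
    (hfix : ClassGroup.mulEquiv (intAut (σ ^ 2)) c = c) :
    (∀ l, classGroupPRank κ l ≤ 2) ∧ ClassicalMuVanishes κ ∧ classicalLambda κ ≤ 2 := by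
  classical
  have hf0 : (fun i : ℕ => if i = 0 then (-1 : ℤ) else if i = 2 then 1 else 0) 0 = -1 := by norm_num
  have hf1 : (fun i : ℕ => if i = 0 then (-1 : ℤ) else if i = 2 then 1 else 0) 1 = 0 := by norm_num
  have hf2 : (fun i : ℕ => if i = 0 then (-1 : ℤ) else if i = 2 then 1 else 0) 2 = 1 := by norm_num
  have hrel : ∏ i ∈ range 3, (ClassGroup.mulEquiv (intAut (σ ^ i)) c) ^
      ((fun i : ℕ => if i = 0 then (-1 : ℤ) else if i = 2 then 1 else 0) i) = 1 := by
    rw [Finset.prod_range_succ, Finset.prod_range_succ, Finset.prod_range_succ, Finset.prod_range_zero, one_mul, hf0, hf1, hf2,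
      zpow_zero, mul_one, zpow_one, pow_zero, mulEquiv_intAut_one, MulEquiv.refl_apply, hfix, zpow_neg, zpow_one, inv_mul_cancel]
  have hF : (∑ i ∈ range 3, C (((fun i : ℕ => if i = 0 then (-1 : ℤ) else if i = 2 then 1 else 0) i)) * X ^ i : ℤ[X]) =
      (X - 1) ^ 2 * 1 + C (2 : ℤ) * (X - 1) := by
    simp only [Finset.sum_range_succ, Finset.sum_range_zero, zero_add]
    norm_num
    ring
  have hu : ¬ (2 : ℤ) ∣ (1 : ℤ[X]).eval 1 := by norm_num
  exact classicalMuVanishes_two_of_relation_of_genusCert_layer_anyDepth hK2 hd κ hκ h2card hh (m := 2) (by norm_num) P hres h2P hunits hπ hA0 hA σ hσ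
    hcA (N := 3) (d := 2) (by norm_num) hu hF hrel

/-- ★★ **`μ₂ > 0` forces `Gal(K_3/K_2)` to MOVE every genus-odd class of `K_3`** (layer three): same base hypotheses; `σ` a generator of `Gal(K_3/K)`, `c ∈ Cl(K_3)` with
the genus certificate for `N_{K_3/K_1}(c)`; IF `σ⁴(c) = c` THEN **`rank₂ Cl(K_l) ≤ 4 ∀ l`, `μ₂(κ) = 0`, `λ₂(κ) ≤ 4`** (relation `c⁻¹·σ⁴(c) = 1`,
`X⁴ − 1 = (X−1)⁴·1 + 2·(2X³ − 3X² + 2X − 1)`, `d = 4 ≤ 2³ − 2`). [cite: Washington1997, §13.3 Prop. 13.22–13.23] [cite: Lang1990, Ch. 13 §4 Lemma 4.1]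
[cite: Gras2003, IV.4] [cite: Fukuda1994, Thm. 1, p. 264] -/
theorem classicalMuVanishes_two_of_genusCert_of_fixed_layer_three (hK2 : ¬ 2 ∣ Module.finrank ℚ K) (hd : ¬ (2 : ℤ) ∣ NumberField.discr K)
    (κ : ZpExtension K 2) (hκ : κ.IsCyclotomic)
    (h2card : {w : HeightOneSpectrum (𝓞 K) | ((2 : ℕ) : 𝓞 K) ∈ w.asIdeal}.ncard = 2)
    (hh : ¬ 2 ∣ classNumber K)
    [NumberField (κ.layer 1)] [NumberField (κ.layer 3)] [Algebra (κ.layer 1) (κ.layer 3)] [IsScalarTower K (κ.layer 1) (κ.layer 3)]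
    (P : Ideal (𝓞 K)) [P.IsMaximal] (hres : ∀ r : 𝓞 K, r ∈ P ∨ r - 1 ∈ P) (h2P : (2 : 𝓞 K) ∈ P)
    (hunits : ∀ u : (𝓞 K)ˣ, (u : 𝓞 K) - 1 ∈ P ^ 3 ∨ (u : 𝓞 K) + 1 ∈ P ^ 3)
    {π : 𝓞 K} (hπ : π - 3 ∈ P ^ 3 ∨ π + 3 ∈ P ^ 3)
    {A : Ideal (𝓞 (κ.layer 1))} (hA0 : A ≠ ⊥) {k : ℕ} (hA : Ideal.relNorm (𝓞 K) A ^ k = Ideal.span {π})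
    (σ : (κ.layer 3) ≃ₐ[K] (κ.layer 3)) (hσ : ∀ τ : (κ.layer 3) ≃ₐ[K] (κ.layer 3), τ ∈ Subgroup.zpowers σ)
    {c : ClassGroup (𝓞 (κ.layer 3))}
    (hcA : classGroupNorm (κ.layer 1) (κ.layer 3) c = ClassGroup.mk0 ⟨A, mem_nonZeroDivisors_of_ne_zero hA0⟩)
    (hfix : ClassGroup.mulEquiv (intAut (σ ^ 4)) c = c) :
    (∀ l, classGroupPRank κ l ≤ 4) ∧ ClassicalMuVanishes κ ∧ classicalLambda κ ≤ 4 := by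
  classical
  have hf0 : (fun i : ℕ => if i = 0 then (-1 : ℤ) else if i = 4 then 1 else 0) 0 = -1 := by norm_num
  have hf1 : (fun i : ℕ => if i = 0 then (-1 : ℤ) else if i = 4 then 1 else 0) 1 = 0 := by norm_num
  have hf2 : (fun i : ℕ => if i = 0 then (-1 : ℤ) else if i = 4 then 1 else 0) 2 = 0 := by norm_num
  have hf3 : (fun i : ℕ => if i = 0 then (-1 : ℤ) else if i = 4 then 1 else 0) 3 = 0 := by norm_num
  have hf4 : (fun i : ℕ => if i = 0 then (-1 : ℤ) else if i = 4 then 1 else 0) 4 = 1 := by norm_num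
  have hrel : ∏ i ∈ range 5, (ClassGroup.mulEquiv (intAut (σ ^ i)) c) ^
      ((fun i : ℕ => if i = 0 then (-1 : ℤ) else if i = 4 then 1 else 0) i) = 1 := by
    rw [Finset.prod_range_succ, Finset.prod_range_succ, Finset.prod_range_succ, Finset.prod_range_succ, Finset.prod_range_succ,
      Finset.prod_range_zero, one_mul, hf0, hf1, hf2, hf3, hf4]
    simp only [zpow_zero, mul_one]
    rw [zpow_one, pow_zero, mulEquiv_intAut_one, MulEquiv.refl_apply, hfix, zpow_neg, zpow_one, inv_mul_cancel]
  have hF : (∑ i ∈ range 5, C (((fun i : ℕ => if i = 0 then (-1 : ℤ) else if i = 4 then 1 else 0) i)) * X ^ i : ℤ[X]) =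
      (X - 1) ^ 4 * 1 + C (2 : ℤ) * (2 * X ^ 3 - 3 * X ^ 2 + 2 * X - 1) := by
    simp only [Finset.sum_range_succ, Finset.sum_range_zero, zero_add]
    norm_num
    ring
  have hu : ¬ (2 : ℤ) ∣ (1 : ℤ[X]).eval 1 := by norm_num
  exact classicalMuVanishes_two_of_relation_of_genusCert_layer_anyDepth hK2 hd κ hκ h2card hh (m := 3) (by norm_num) P hres h2P hunits hπ hA0 hA σ hσ
    hcA (N := 5) (d := 4) (by norm_num) hu hF hrel

end Literature.NumberTheory.IwasawaTheory

end
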